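import Literature.NumberTheory.Automorphic.DoubledUnitaryRankOneSL2Model
import Literature.NumberTheory.Automorphic.SL2AdelicReduction
import Literature.NumberTheory.Automorphic.ChirpDilationSupReduction
import Literature.NumberTheory.Automorphic.AdeleGaloisDescent
import Literature.NumberTheory.Automorphic.NormOneTorusAdelicCompact
import HarnessLib

/-!
# Reduction theory for the Borel subgroup of the rank-one doubled unitary group `U(1,1)_{E/F}`

Topic `NumberTheory/Automorphic`; namespace `Literature.NumberTheory.Automorphic.DoubledUnitary.RankOneReduction`.
KERNEL ONLY (theorems; no definition, no named fact).

Let `E/F` be a quadratic extension of number fields with non-trivial automorphism `c`, `δ ∈ Eˣ` with `c δ = -δ`,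
and let `U = U(c ⊗ 1, J₁)(𝔸_F) ≤ GL₂(𝔸_E)` be the adelic points of the quasi-split unitary group in two variables
in its split anti-diagonal model `J₁ = !![0,1;1,0]` (the tree's `unitaryGroupOfForm (UnitaryGroup.conjAdele F E c) J₁`,
i.e. `UnitaryGroup.adelic F E c 2 J₁` after unfolding `adelicForm`).  The Borel subgroup `P = M N` of `U` consists of
the upper-triangular elements `p = d(τ) t(b)`, `d(τ) = diag(τ, (c̄τ)⁻¹)` (`τ ∈ 𝕀_E`), `t(b) = !![1,b;0,1]` (`c̄ b = -b`).

**Main result** (`exists_borel_reduction`, Weil's Lemma 20 of *Sur la formule de Siegel…* (1965) n° 49 for the pair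
`(U(1,1), ·)`, equivalently Borel's reduction theory for the `F`-rank-one group `U(1,1)_{E/F}`): there are `t > 0` and a
compact `K ⊆ GL₂(𝔸_E)` such that every upper-triangular `p ∈ U(𝔸_F)` factors as
`p = γ · ι(a) · k`, with `γ ∈ U(𝔸_F)` an `E`-RATIONAL matrix (so `γ ∈ U(F)`), `a = diag(z(s), z(s)⁻¹)` in the Siegel cone
`A_{T₀}(t)` of `SL₂ /F` (`s² ≥ t`, ★ `siegelCone 2 F t`) base-changed to `𝔸_E`, and `k ∈ K ∩ U(𝔸_F)`.

**Proof** (transport, no new arithmetic): write `p₀₀ = τ = q · c · z_E(r)` with `q ∈ Eˣ`, `c` in a fixed compact of `𝕀_E`,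
`z_E(r)` the positive real scalar idele (★ `exists_isCompact_idele_decomposition`, compactness of `𝕀_E¹/Eˣ`); then `x' := d(q)⁻¹ · p · d(c)⁻¹ ∈ U(𝔸_F)` has determinant `z_E(r) · (c̄ z_E(r))⁻¹ = 1`, hence lies in the
image of `φ_δ : SL₂(𝔸_F) ≅ SU(1,1)(𝔸_F)` (★ `RankOneSL2.mem_range_sl2Hom_iff_det_eq_one`, using Galois descent
`𝔸_E^{c ⊗ 1} = 𝔸_F`, ★ `AdeleRing.mem_range_baseChange_iff`); reduction theory for `SL₂(𝔸_F)`
(★ `SL2Reduction.exists_reduction`: `g = γ₁ a c₁`) and `φ_δ(diag) = diag` finish: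
`p = (d(q) φ_δ(γ₁)) · ι(a) · (φ_δ(c₁) d(c))`.

References: A. Weil, *Sur la formule de Siegel dans la théorie des groupes classiques*, Acta Math. 113 (1965), n° 49 Lemme 20;
A. Borel, *Some finiteness properties of adele groups over number fields*, Publ. IHES 16 (1963), §5; S. Gelbart, J. Rogawski,
Invent. Math. 105 (1991), §1 (`U(1,1)`, `SU(1,1) ≅ SL₂`); V. Platonov, A. Rapinchuk, *Algebraic groups and number theory* (1994), §2.3.
-/

noncomputable section

open NumberField IsDedekindDomain Matrix Set
open scoped MatrixGroups NNReal Pointwise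

namespace Literature.NumberTheory.Automorphic.DoubledUnitary.RankOneReduction

/-! ## §1 Matrix algebra over a commutative ring `S` with an endomorphism `τ` -/

section Algebra

variable {R S : Type*} [CommRing R] [CommRing S] (f : R →+* S) (τ : S →+* S) (δ : Sˣ)

/-- The matrix of `glDiagonal 2 S ![a, b]` is `!![a, 0; 0, b]`. [folklore] -/
private theorem coe_glDiagonal_two (a b : Sˣ) :
    ((glDiagonal 2 S ![a, b] : GL (Fin 2) S) : Matrix (Fin 2) (Fin 2) S) = !![(a : S), 0; 0, (b : S)] := by
  rw [coe_glDiagonal]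
  ext i j
  fin_cases i <;> fin_cases j <;> simp

/-- `det (glDiagonal 2 S ![a, b]) = a b`. [folklore] -/
private theorem det_glDiagonal_two (a b : Sˣ) :
    Matrix.GeneralLinearGroup.det (glDiagonal 2 S ![a, b]) = a * b := by
  ext
  rw [Matrix.GeneralLinearGroup.val_det_apply, coe_glDiagonal_two, Matrix.det_fin_two_of, Units.val_mul]
  ring

/-- `(glDiagonal 2 S ![1, δ])⁻¹ = glDiagonal 2 S ![1, δ⁻¹]`. [folklore] -/
private theorem glDiagonal_one_inv :
    (glDiagonal 2 S ![1, δ])⁻¹ = glDiagonal 2 S ![1, δ⁻¹] := by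
  rw [← map_inv]
  congr 1
  ext i : 1
  fin_cases i <;> simp

/-- **The diagonal torus of `U(τ, J₁)`**: `diag(u, w) ∈ U(τ, J₁)` as soon as `τ(u) w = 1 = τ(w) u` (for an involution `τ`:
`w = (τ u)⁻¹`, the element `d(u) = diag(u, (τu)⁻¹)` of the Levi factor `M ≅ Res_{E∕F} GL₁`).
[cite: GelbartRogawski1991, §1] -/
theorem glDiagonal_mem_unitaryGroupOfForm {u w : Sˣ} (huw : τ (u : S) * (w : S) = 1) (hwu : τ (w : S) * (u : S) = 1) :
    glDiagonal 2 S ![u, w] ∈ unitaryGroupOfForm τ (!![(0 : S), 1; 1, 0] : Matrix (Fin 2) (Fin 2) S) := by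
  rw [mem_unitaryGroupOfForm_iff, coe_glDiagonal_two]
  ext i j
  fin_cases i <;> fin_cases j <;>
    simp [Matrix.mul_apply, Fin.sum_univ_two, Matrix.map_apply, huw, hwu]

/-- For an involution `τ`: `d(u) = diag(u, (τu)⁻¹) ∈ U(τ, J₁)`. [cite: GelbartRogawski1991, §1] -/
theorem diag_mem_unitaryGroupOfForm (hτ : ∀ s, τ (τ s) = s) (u : Sˣ) :
    glDiagonal 2 S ![u, (Units.map (τ : S →* S) u)⁻¹] ∈
      unitaryGroupOfForm τ (!![(0 : S), 1; 1, 0] : Matrix (Fin 2) (Fin 2) S) := by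
  refine glDiagonal_mem_unitaryGroupOfForm τ ?_ ?_
  · exact_mod_cast (Units.map (τ : S →* S) u).mul_inv
  · rw [← map_inv, Units.coe_map, MonoidHom.coe_coe, hτ]
    exact_mod_cast u.inv_mul

/-- The matrix of `Φ_δ(y) := D · f(y) · D⁻¹`, `D = diag(1, δ)`: `!![f y₀₀, f y₀₁ δ⁻¹; δ f y₁₀, f y₁₁]` — the formula of
★ `RankOneSL2.exists_sl2Hom`, now for every `y ∈ GL₂(R)`. [cite: PlatonovRapinchuk1994, §2.3] -/
theorem coe_conj_map (y : GL (Fin 2) R) :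
    ((glDiagonal 2 S ![1, δ] * Matrix.GeneralLinearGroup.map f y * (glDiagonal 2 S ![1, δ])⁻¹ : GL (Fin 2) S) :
        Matrix (Fin 2) (Fin 2) S) =
      !![f ((y : Matrix (Fin 2) (Fin 2) R) 0 0), f ((y : Matrix (Fin 2) (Fin 2) R) 0 1) * ((δ⁻¹ : Sˣ) : S);
        (δ : S) * f ((y : Matrix (Fin 2) (Fin 2) R) 1 0), f ((y : Matrix (Fin 2) (Fin 2) R) 1 1)] := by
  rw [glDiagonal_one_inv, Units.val_mul, Units.val_mul, coe_glDiagonal_two, coe_glDiagonal_two]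
  have hmap : ((Matrix.GeneralLinearGroup.map f y : GL (Fin 2) S) : Matrix (Fin 2) (Fin 2) S) =
      (y : Matrix (Fin 2) (Fin 2) R).map f := rfl
  rw [hmap]
  ext i j
  fin_cases i <;> fin_cases j <;> simp [Matrix.mul_apply, Fin.sum_univ_two, Matrix.vecMul, dotProduct, mul_comm]

/-- **`Φ_δ(y) ∈ U(τ, J₁)` whenever `det y = 1`** (`f` takes values in the `τ`-fixed subring, `τ δ = -δ`;
★ `RankOneSL2.conjDiag_unitary`). [cite: PlatonovRapinchuk1994, §2.3] -/
theorem conj_map_mem_unitaryGroupOfForm (hτf : ∀ r, τ (f r) = f r) (hδ : τ (δ : S) = -(δ : S)) {y : GL (Fin 2) R}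
    (hy : Matrix.GeneralLinearGroup.det y = 1) :
    glDiagonal 2 S ![1, δ] * Matrix.GeneralLinearGroup.map f y * (glDiagonal 2 S ![1, δ])⁻¹ ∈
      unitaryGroupOfForm τ (!![(0 : S), 1; 1, 0] : Matrix (Fin 2) (Fin 2) S) := by
  rw [mem_unitaryGroupOfForm_iff, coe_conj_map]
  have hdet : (y : Matrix (Fin 2) (Fin 2) R) 0 0 * (y : Matrix (Fin 2) (Fin 2) R) 1 1 -
      (y : Matrix (Fin 2) (Fin 2) R) 0 1 * (y : Matrix (Fin 2) (Fin 2) R) 1 0 = 1 := by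
    have h := congrArg (fun u : Rˣ => (u : R)) hy
    simp only [Matrix.GeneralLinearGroup.val_det_apply, Units.val_one, Matrix.det_fin_two] at h
    exact h
  exact RankOneSL2.conjDiag_unitary f τ δ hτf hδ hdet

/-- `Φ_δ` extends `φ_δ`: `Φ_δ(g) = φ_δ(g)` for `g ∈ SL₂(R)` (same matrix). [cite: PlatonovRapinchuk1994, §2.3] -/
theorem conj_map_toGL_eq {φ : SL(2, R) →* unitaryGroupOfForm τ (!![(0 : S), 1; 1, 0] : Matrix (Fin 2) (Fin 2) S)}
    (hφ : ∀ g : SL(2, R), (((φ g : unitaryGroupOfForm τ (!![(0 : S), 1; 1, 0] : Matrix (Fin 2) (Fin 2) S)) :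
      GL (Fin 2) S) : Matrix (Fin 2) (Fin 2) S) =
        !![f (g 0 0), f (g 0 1) * ((δ⁻¹ : Sˣ) : S); (δ : S) * f (g 1 0), f (g 1 1)])
    (g : SL(2, R)) :
    glDiagonal 2 S ![1, δ] * Matrix.GeneralLinearGroup.map f (Matrix.SpecialLinearGroup.toGL g) *
        (glDiagonal 2 S ![1, δ])⁻¹ =
      ((φ g : unitaryGroupOfForm τ (!![(0 : S), 1; 1, 0] : Matrix (Fin 2) (Fin 2) S)) : GL (Fin 2) S) := by
  ext : 1
  rw [coe_conj_map, hφ, Matrix.SpecialLinearGroup.coe_GL_coe_matrix]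

/-- `f` commutes with diagonal matrices: `f(diag d) = diag(f ∘ d)`. [folklore] -/
private theorem map_glDiagonal (d : Fin 2 → Rˣ) :
    Matrix.GeneralLinearGroup.map f (glDiagonal 2 R d) = glDiagonal 2 S fun i => Units.map (f : R →* S) (d i) := by
  ext i j : 2
  change f ((glDiagonal 2 R d : Matrix (Fin 2) (Fin 2) R) i j) = _
  rw [coe_glDiagonal, coe_glDiagonal, Matrix.diagonal_apply, Matrix.diagonal_apply]
  split_ifs <;> simp

/-- `Φ_δ(diag d) = f(diag d)` (diagonal matrices commute with `D = diag(1, δ)`). [folklore] -/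
private theorem conj_map_glDiagonal (d : Fin 2 → Rˣ) :
    glDiagonal 2 S ![1, δ] * Matrix.GeneralLinearGroup.map f (glDiagonal 2 R d) * (glDiagonal 2 S ![1, δ])⁻¹ =
      Matrix.GeneralLinearGroup.map f (glDiagonal 2 R d) := by
  rw [map_glDiagonal, mul_inv_eq_iff_eq_mul, ← map_mul, ← map_mul, mul_comm]

end Algebra

/-! ## §2 The quadratic extension `E/F`: descent data for `c ⊗ 1` on `𝔸_E` -/

section Descent

variable (F E : Type) [Field F] [NumberField F] [Field E] [NumberField E] [Algebra F E] (c : E ≃ₐ[F] E)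

omit [NumberField F] [NumberField E] in
/-- `c² = 1` for the generator of a group of order `≤ 2`. [folklore] -/
private theorem mul_self_eq_one (h2 : ∀ σ : E ≃ₐ[F] E, σ = 1 ∨ σ = c) : c * c = 1 := by
  rcases h2 (c * c) with h | h
  · exact h
  · have hc : c = 1 := mul_left_cancel (a := c) (by rw [h, mul_one])
    rw [hc, mul_one]

omit [NumberField F] in
/-- `(c ⊗ 1)² = 1` on `𝔸_E`. [cite: CasselsFrohlichANT1967, Ch. VII §1.1] -/
theorem conjAdele_conjAdele (h2 : ∀ σ : E ≃ₐ[F] E, σ = 1 ∨ σ = c) (x : AdeleRing (𝓞 E) E) :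
    UnitaryGroup.conjAdele F E c (UnitaryGroup.conjAdele F E c x) = x := by
  rw [UnitaryGroup.conjAdele_apply, UnitaryGroup.conjAdele_apply, smul_smul, mul_self_eq_one F E c h2, one_smul]

/-- **Galois descent `𝔸_E^{c ⊗ 1} = 𝔸_F`** for the quadratic extension `E/F` (★ `AdeleRing.mem_range_baseChange_iff`).
[cite: CasselsFrohlichANT1967, Ch. II §14] -/
theorem exists_baseChange_eq_of_conjAdele_eq [IsGalois F E] (h2 : ∀ σ : E ≃ₐ[F] E, σ = 1 ∨ σ = c)
    (s : AdeleRing (𝓞 E) E) (hs : UnitaryGroup.conjAdele F E c s = s) :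
    ∃ r : AdeleRing (𝓞 F) F, AdeleRing.baseChange F E r = s := by
  rw [UnitaryGroup.conjAdele_apply] at hs
  have h : s ∈ Set.range (AdeleRing.baseChange F E) := by
    refine (AdeleRing.mem_range_baseChange_iff F E s).2 fun σ => ?_
    rcases h2 σ with hσ | hσ
    · rw [hσ, one_smul]
    · rw [hσ, hs]
  exact h

omit [NumberField F] in
/-- `(c ⊗ 1)(δ) = -δ` in `𝔸_E` for `δ ∈ E` with `c δ = -δ` (★ `UnitaryGroup.algebraMap_conj`). [cite: CasselsFrohlichANT1967, Ch. VII §1.1] -/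
theorem conjAdele_algebraMap_eq_neg (δ : E) (hcδ : c δ = -δ) :
    UnitaryGroup.conjAdele F E c (algebraMap E (AdeleRing (𝓞 E) E) δ) = -algebraMap E (AdeleRing (𝓞 E) E) δ := by
  rw [← map_neg, ← hcδ]
  exact (UnitaryGroup.algebraMap_conj F E c δ).symm

end Descent

/-! ## §3 Topology: continuity of `Φ_δ` and of the diagonal torus -/

section Topology

variable {R S : Type*} [CommRing R] [CommRing S] [TopologicalSpace R] [IsTopologicalRing R] [TopologicalSpace S]
  [IsTopologicalRing S]

omit [IsTopologicalRing R] in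
/-- `y ↦ D · f(y) · D⁻¹` is continuous for continuous `f` (units topologies). [folklore] -/
private theorem continuous_conj_map {f : R →+* S} (hf : Continuous f) (D : GL (Fin 2) S) :
    Continuous fun y : GL (Fin 2) R => D * Matrix.GeneralLinearGroup.map f y * D⁻¹ :=
  (continuous_const.mul hf.generalLinearGroup_map).mul continuous_const

/-- `u ↦ d(u) = diag(u, (τu)⁻¹)` is continuous for continuous `τ` (★ `continuous_glDiagonal`). [folklore] -/
private theorem continuous_diag {τ : S →+* S} (hτ : Continuous τ) :
    Continuous fun u : Sˣ => glDiagonal 2 S ![u, (Units.map (τ : S →* S) u)⁻¹] := by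
  refine (continuous_glDiagonal (n := 2) S).comp (continuous_pi fun i => ?_)
  fin_cases i
  · exact continuous_id
  · exact (Continuous.units_map (τ : S →* S) hτ).inv

end Topology

/-! ## §4 Rationality: `d(q)` for `q ∈ Eˣ` and `Φ_δ(γ)` for `γ ∈ SL₂(F)` are `E`-rational matrices -/

section Rational

variable (F E : Type) [Field F] [NumberField F] [Field E] [NumberField E] [Algebra F E] (c : E ≃ₐ[F] E)

omit [NumberField F] in
/-- `d(q) = diag(q, (c̄ q)⁻¹)` is the image of an `E`-rational diagonal matrix for a principal idele `q ∈ Eˣ`.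
[cite: GelbartRogawski1991, §1] -/
theorem diag_principal_eq_map (q₀ : Eˣ) :
    glDiagonal 2 (AdeleRing (𝓞 E) E)
        ![Units.map (algebraMap E (AdeleRing (𝓞 E) E) : E →* AdeleRing (𝓞 E) E) q₀,
          (Units.map (UnitaryGroup.conjAdele F E c : AdeleRing (𝓞 E) E →* AdeleRing (𝓞 E) E)
            (Units.map (algebraMap E (AdeleRing (𝓞 E) E) : E →* AdeleRing (𝓞 E) E) q₀))⁻¹] =
      Matrix.GeneralLinearGroup.map (algebraMap E (AdeleRing (𝓞 E) E))
        (glDiagonal 2 E ![q₀, (Units.map ((c : E →+* E) : E →* E) q₀)⁻¹]) := by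
  have key : ∀ x : E, UnitaryGroup.conjAdele F E c (algebraMap E (AdeleRing (𝓞 E) E) x) =
      algebraMap E (AdeleRing (𝓞 E) E) ((c : E →+* E) x) := fun x => (UnitaryGroup.algebraMap_conj F E c x).symm
  ext i j : 2
  rw [Matrix.GeneralLinearGroup.map_apply, coe_glDiagonal_two, coe_glDiagonal_two]
  fin_cases i <;> fin_cases j <;> simp [key]

/-- `Φ_δ(ι_F γ) = ι_E(D γ D⁻¹)` for `γ ∈ GL₂(F)`: `Φ_δ` maps `F`-rational matrices to `E`-rational ones
(`(a)_{𝔸_F} ↦ (a)_{𝔸_E}`, ★ `AdeleRing.baseChange_algebraMap`). [cite: PlatonovRapinchuk1994, §2.3] -/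
theorem conj_map_rational (δ : Eˣ) (γ₀ : GL (Fin 2) F) :
    glDiagonal 2 (AdeleRing (𝓞 E) E) ![1, Units.map (algebraMap E (AdeleRing (𝓞 E) E) : E →* AdeleRing (𝓞 E) E) δ] *
        Matrix.GeneralLinearGroup.map (AdeleRing.baseChange F E : AdeleRing (𝓞 F) F →+* AdeleRing (𝓞 E) E)
          (Matrix.GeneralLinearGroup.map (algebraMap F (AdeleRing (𝓞 F) F)) γ₀) *
        (glDiagonal 2 (AdeleRing (𝓞 E) E)
          ![1, Units.map (algebraMap E (AdeleRing (𝓞 E) E) : E →* AdeleRing (𝓞 E) E) δ])⁻¹ =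
      Matrix.GeneralLinearGroup.map (algebraMap E (AdeleRing (𝓞 E) E))
        (glDiagonal 2 E ![1, δ] * Matrix.GeneralLinearGroup.map (algebraMap F E) γ₀ * (glDiagonal 2 E ![1, δ])⁻¹) := by
  ext i j : 2
  rw [coe_conj_map, Matrix.GeneralLinearGroup.map_apply (f := algebraMap E (AdeleRing (𝓞 E) E)), coe_conj_map]
  fin_cases i <;> fin_cases j <;>
    simp [Matrix.GeneralLinearGroup.map_apply, AdeleRing.baseChange_algebraMap]

end Rational

/-! ## §5 Reduction theory for the Borel subgroup of `U(1,1)_{E/F}(𝔸_F)` -/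

section Main

variable (F E : Type) [Field F] [NumberField F] [Field E] [NumberField E] [Algebra F E] (c : E ≃ₐ[F] E)

/-- `det x = 1` in `Sˣ` from the unit-level identity (comm-group bookkeeping for the proof of `exists_borel_reduction`). [folklore] -/
private theorem units_bookkeeping {G : Type*} [CommGroup G] (ν : G →* G) {q cc ρ x : G} (hx : x = q * cc * ρ)
    (hρ : ν ρ = ρ) : (q * (ν q)⁻¹)⁻¹ * (x * (ν x)⁻¹) * (cc * (ν cc)⁻¹)⁻¹ = 1 := by
  subst hx
  rw [map_mul, map_mul, hρ]
  apply_fun Additive.ofMul using Additive.ofMul.injective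
  simp only [ofMul_mul, ofMul_inv, ofMul_one]
  abel

/-- **Reduction theory for the Borel subgroup of `U(1,1)_{E/F}`** (Weil (1965) n° 49 Lemme 20 for the rank-one doubled
unitary group; Borel (1963) §5).  `E/F` a quadratic extension of number fields with `Gal(E/F) = {1, c}`, `δ ∈ Eˣ` with
`c δ = -δ`, `U = U(c ⊗ 1, J₁)(𝔸_F) ≤ GL₂(𝔸_E)` (`J₁ = !![0,1;1,0]`).  There are `t > 0` and a compact
`K ⊆ GL₂(𝔸_E)` such that EVERY UPPER-TRIANGULAR `p ∈ U` — i.e. every `p = d(τ) t(b)`, `τ ∈ 𝕀_E`, `c̄ b = -b` — factors as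
`p = γ · ι(a) · k` with `γ ∈ U` an `E`-rational matrix (`γ ∈ U(F)`), `a ∈ A_{T₀}(t)` the Siegel cone of `SL₂ /F`
(★ `siegelCone 2 F t`: `a = diag(z(s₀), z(s₁))`, `s₀ s₁ = 1`, `t s₁ ≤ s₀`) base-changed along `ι : 𝔸_F → 𝔸_E`, and
`k ∈ K ∩ U`.  [cite: Weil1965, n° 49 Lemme 20] -/
theorem exists_borel_reduction [IsGalois F E] (h2 : ∀ σ : E ≃ₐ[F] E, σ = 1 ∨ σ = c) (δ : Eˣ)
    (hcδ : c (δ : E) = -(δ : E)) :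
    ∃ t : ℝ, 0 < t ∧ ∃ K : Set (GL (Fin 2) (AdeleRing (𝓞 E) E)), IsCompact K ∧
      ∀ p : GL (Fin 2) (AdeleRing (𝓞 E) E),
        p ∈ unitaryGroupOfForm (UnitaryGroup.conjAdele F E c)
            (!![(0 : AdeleRing (𝓞 E) E), 1; 1, 0] : Matrix (Fin 2) (Fin 2) (AdeleRing (𝓞 E) E)) →
        (p : Matrix (Fin 2) (Fin 2) (AdeleRing (𝓞 E) E)) 1 0 = 0 →
        ∃ γ ∈ unitaryGroupOfForm (UnitaryGroup.conjAdele F E c)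
            (!![(0 : AdeleRing (𝓞 E) E), 1; 1, 0] : Matrix (Fin 2) (Fin 2) (AdeleRing (𝓞 E) E)),
          γ ∈ (Matrix.GeneralLinearGroup.map (algebraMap E (AdeleRing (𝓞 E) E))).range ∧
          ∃ a ∈ siegelCone 2 F t, ∃ k ∈ K,
            k ∈ unitaryGroupOfForm (UnitaryGroup.conjAdele F E c)
                (!![(0 : AdeleRing (𝓞 E) E), 1; 1, 0] : Matrix (Fin 2) (Fin 2) (AdeleRing (𝓞 E) E)) ∧
            p = γ * Matrix.GeneralLinearGroup.map
                  (AdeleRing.baseChange F E : AdeleRing (𝓞 F) F →+* AdeleRing (𝓞 E) E) a * k := by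
  classical
  -- abbreviations
  set τ : AdeleRing (𝓞 E) E →+* AdeleRing (𝓞 E) E := UnitaryGroup.conjAdele F E c with hτdef
  set f : AdeleRing (𝓞 F) F →+* AdeleRing (𝓞 E) E := AdeleRing.baseChange F E with hfdef
  set ιE : E →+* AdeleRing (𝓞 E) E := algebraMap E (AdeleRing (𝓞 E) E) with hιE
  set δA : (AdeleRing (𝓞 E) E)ˣ := Units.map (ιE : E →* AdeleRing (𝓞 E) E) δ with hδAdef
  set D : GL (Fin 2) (AdeleRing (𝓞 E) E) := glDiagonal 2 (AdeleRing (𝓞 E) E) ![1, δA] with hDdef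
  set J : Matrix (Fin 2) (Fin 2) (AdeleRing (𝓞 E) E) := !![(0 : AdeleRing (𝓞 E) E), 1; 1, 0] with hJ
  -- descent data
  have hτf : ∀ r, τ (f r) = f r := fun r => by
    rw [hτdef, UnitaryGroup.conjAdele_apply, hfdef, AdeleRing.smul_baseChange]
  have hττ : ∀ s, τ (τ s) = s := conjAdele_conjAdele F E c h2
  have hδA : τ (δA : AdeleRing (𝓞 E) E) = -(δA : AdeleRing (𝓞 E) E) := conjAdele_algebraMap_eq_neg F E c δ hcδ
  have hinj : Function.Injective f := AdeleRing.baseChange_injective F E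
  have hfix : ∀ s : AdeleRing (𝓞 E) E, τ s = s → ∃ r, f r = s := exists_baseChange_eq_of_conjAdele_eq F E c h2
  -- the two reduction inputs
  obtain ⟨t, ht, C₁, hC₁c, hC₁det, hred⟩ := SL2Reduction.exists_reduction F
  obtain ⟨CE, hCEc, hdecE⟩ := exists_isCompact_idele_decomposition E
  -- `Φ_δ` and `d`
  let Φ : GL (Fin 2) (AdeleRing (𝓞 F) F) →* GL (Fin 2) (AdeleRing (𝓞 E) E) :=
    (MulAut.conj D).toMonoidHom.comp (Matrix.GeneralLinearGroup.map f)
  have hΦ : ∀ y, Φ y = D * Matrix.GeneralLinearGroup.map f y * D⁻¹ := fun y => rfl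
  let d : (AdeleRing (𝓞 E) E)ˣ → GL (Fin 2) (AdeleRing (𝓞 E) E) := fun u => glDiagonal 2 (AdeleRing (𝓞 E) E) ![u, (Units.map (τ : AdeleRing (𝓞 E) E →* AdeleRing (𝓞 E) E) u)⁻¹]
  have hdmem : ∀ u, d u ∈ unitaryGroupOfForm τ J := fun u => diag_mem_unitaryGroupOfForm τ hττ u
  have hdmul : ∀ u v, d (u * v) = d u * d v := fun u v => by
    simp only [d, ← map_mul]
    congr 1
    ext i : 1
    match i with
    | ⟨0, _⟩ => rfl
    | ⟨1, _⟩ => simp [mul_comm]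
  have hddet : ∀ u, Matrix.GeneralLinearGroup.det (d u) = u * (Units.map (τ : AdeleRing (𝓞 E) E →* AdeleRing (𝓞 E) E) u)⁻¹ := fun u =>
    det_glDiagonal_two u _
  have hΦmem : ∀ y, Matrix.GeneralLinearGroup.det y = 1 → Φ y ∈ unitaryGroupOfForm τ J := fun y hy =>
    conj_map_mem_unitaryGroupOfForm f τ δA hτf hδA hy
  -- the compact set
  refine ⟨t, ht, Φ '' C₁ * d '' CE, ?_, fun p hp hp10 => ?_⟩
  · have hτc : Continuous τ := by
      rw [hτdef]
      exact (AdeleRing.continuous_smul F c).congr fun x => (UnitaryGroup.conjAdele_apply F E c x).symm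
    exact (hC₁c.image ((continuous_conj_map (AdeleRing.continuous_baseChange F E) D).congr fun y => (hΦ y).symm)).mul
      (hCEc.image (continuous_diag hτc))
  -- the entries of `p`
  set P : Matrix (Fin 2) (Fin 2) (AdeleRing (𝓞 E) E) := (p : Matrix (Fin 2) (Fin 2) (AdeleRing (𝓞 E) E)) with hP
  have E01 := RankOneSL2.unitarity_apply hp 0 1
  have E10 := RankOneSL2.unitarity_apply hp 1 0
  simp only [← hP, Matrix.of_apply, Matrix.cons_val', Matrix.cons_val_zero, Matrix.cons_val_one,
    Matrix.cons_val_fin_one, Matrix.empty_val', hp10, map_zero, zero_mul, zero_add, mul_zero, add_zero] at E01 E10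
  -- `E01 : τ (P 0 0) * P 1 1 = 1`, `E10 : τ (P 1 1) * P 0 0 = 1`
  set xu : (AdeleRing (𝓞 E) E)ˣ := Units.mkOfMulEqOne (P 0 0) (τ (P 1 1)) (by rw [mul_comm]; exact E10) with hxu
  have hxu0 : (xu : AdeleRing (𝓞 E) E) = P 0 0 := rfl
  have hP11 : P 1 1 = (((Units.map (τ : AdeleRing (𝓞 E) E →* AdeleRing (𝓞 E) E) xu)⁻¹ : (AdeleRing (𝓞 E) E)ˣ) : AdeleRing (𝓞 E) E) :=
    (Units.inv_eq_of_mul_eq_one_right (u := Units.map (τ : AdeleRing (𝓞 E) E →* AdeleRing (𝓞 E) E) xu) E01).symm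
  have hdetp : Matrix.GeneralLinearGroup.det p = xu * (Units.map (τ : AdeleRing (𝓞 E) E →* AdeleRing (𝓞 E) E) xu)⁻¹ := by
    ext
    rw [Matrix.GeneralLinearGroup.val_det_apply, Matrix.det_fin_two, ← hP, hp10, mul_zero, sub_zero, Units.val_mul,
      hxu0, hP11]
  -- decompose `xu = q · cc · z(r)`
  obtain ⟨q, hq, cc, hcc, r, hx⟩ := hdecE xu
  obtain ⟨q₀, rfl⟩ := hq
  have hρ : Units.map (τ : AdeleRing (𝓞 E) E →* AdeleRing (𝓞 E) E) (posRealIdele E r) = posRealIdele E r := by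
    ext
    rw [Units.coe_map, MonoidHom.coe_coe, ← AdeleRing.ideleBaseChange_posRealIdele F E, AdeleRing.coe_ideleBaseChange]
    exact hτf _
  -- the special unitary middle factor
  set x' : GL (Fin 2) (AdeleRing (𝓞 E) E) := (d (Units.map (ιE : E →* AdeleRing (𝓞 E) E) q₀))⁻¹ * p * (d cc)⁻¹ with hx'
  have hx'U : x' ∈ unitaryGroupOfForm τ J :=
    Subgroup.mul_mem _ (Subgroup.mul_mem _ (Subgroup.inv_mem _ (hdmem _)) hp) (Subgroup.inv_mem _ (hdmem _))
  have hx'det : Matrix.GeneralLinearGroup.det x' = 1 := by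
    rw [hx', map_mul, map_mul, map_inv, map_inv, hddet, hddet, hdetp]
    exact units_bookkeeping (Units.map (τ : AdeleRing (𝓞 E) E →* AdeleRing (𝓞 E) E)) hx hρ
  have hx'det' : Matrix.det (x' : Matrix (Fin 2) (Fin 2) (AdeleRing (𝓞 E) E)) = 1 := by
    have h := congrArg (fun u : (AdeleRing (𝓞 E) E)ˣ => (u : AdeleRing (𝓞 E) E)) hx'det
    simpa only [Matrix.GeneralLinearGroup.val_det_apply, Units.val_one] using h
  obtain ⟨φ, hφ⟩ := RankOneSL2.exists_sl2Hom f τ δA hτf hδA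
  obtain ⟨g, hg⟩ := (RankOneSL2.mem_range_sl2Hom_iff_det_eq_one hφ hinj hfix hδA ⟨x', hx'U⟩).2 hx'det'
  have hΦg : Φ (Matrix.SpecialLinearGroup.toGL g) = x' := by
    rw [hΦ, conj_map_toGL_eq f τ δA hφ g, hg]
  -- reduction theory for `SL₂(𝔸_F)`
  obtain ⟨γ₁, hγ₁, hγ₁det, a, ha, c₁, hc₁, hprod⟩ :=
    hred (Matrix.SpecialLinearGroup.toGL g) (Matrix.SpecialLinearGroup.coeToGL_det g)
  obtain ⟨γ₀, rfl⟩ := hγ₁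
  have hadet : Matrix.GeneralLinearGroup.det a = 1 := by
    have h := congrArg Matrix.GeneralLinearGroup.det hprod
    rw [map_mul, map_mul, hγ₁det, hC₁det c₁ hc₁, one_mul, mul_one, Matrix.SpecialLinearGroup.coeToGL_det] at h
    exact h
  -- `Φ_δ(a) = ι(a)` for the diagonal `a`
  have hΦa : Φ a = Matrix.GeneralLinearGroup.map f a := by
    obtain ⟨b, -, -, rfl⟩ := ha
    rw [hΦ, posRealDiagonal_apply]
    exact conj_map_glDiagonal f δA _
  -- assemble
  refine ⟨d (Units.map (ιE : E →* AdeleRing (𝓞 E) E) q₀) * Φ (Matrix.GeneralLinearGroup.map (algebraMap F (AdeleRing (𝓞 F) F)) γ₀),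
    Subgroup.mul_mem _ (hdmem _) (hΦmem _ hγ₁det), ?_, a, ha, Φ c₁ * d cc,
    Set.mul_mem_mul (Set.mem_image_of_mem _ hc₁) (Set.mem_image_of_mem _ hcc),
    Subgroup.mul_mem _ (hΦmem _ (hC₁det c₁ hc₁)) (hdmem _), ?_⟩
  · -- rationality of `γ`
    refine ⟨glDiagonal 2 E ![q₀, (Units.map ((c : E →+* E) : E →* E) q₀)⁻¹] *
      (glDiagonal 2 E ![1, δ] * Matrix.GeneralLinearGroup.map (algebraMap F E) γ₀ * (glDiagonal 2 E ![1, δ])⁻¹), ?_⟩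
    rw [map_mul, ← diag_principal_eq_map F E c q₀, ← conj_map_rational F E δ γ₀, hΦ]
  · -- the factorisation
    have hpx : p = d (Units.map (ιE : E →* AdeleRing (𝓞 E) E) q₀) * x' * d cc := by
      simp only [hx', mul_assoc, inv_mul_cancel, mul_one, mul_inv_cancel_left]
    rw [← hΦa, ← mul_assoc, mul_assoc (d _), ← map_mul, mul_assoc (d _), ← map_mul, hprod, hΦg, hpx,
      mul_assoc, mul_assoc, mul_assoc]

end Main

end Literature.NumberTheory.Automorphic.DoubledUnitary.RankOneReduction
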